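import Mathlib
import HarnessLib

/-!
# The exponential-polynomial regime, CXXI: A LOWER EDGE OF THE NEWTON POLYGON (combinatorics)

HONEST FRAMING.  Cell `pub-schanuel` (Zilber's Exponential-Algebraic Closedness, case ladder;
host summit Schanuel), seat 2, gen 35.  Elementary combinatorics of a finite set of lattice
points `S ⊂ ℕ²` (the support, modulo the curve, of the fibre relation
`P = Σ P_{ij} y₀^i y₁^j` of a surface): if `S` has two points with distinct first coordinates,
there is a primitive integer functional `ℓ(i, j) = a·j − b·i` with `a ≥ 1` (a NON-VERTICAL edge
direction `(a, b)` of the LOWER boundary, completed to a unimodular matrix by `a d − b c = 1`)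
attaining its minimum on `S` at two distinct points: **`exists_lowerEdge`**.  After the monomial
change `y₀ = y₀'^{±d} y₁'^{∓b}`, `y₁ = y₀'^{∓c} y₁'^{a}` the `y₁'`-exponent of `y₀^i y₁^j` is
`ℓ(i, j)`, so this edge becomes the bottom edge — the input of the degenerate-direction engine
(files CXV (b), CXVIII).  [folklore]; nothing here is specific to Schanuel's conjecture (neither
used nor implied); Mantova–Masser's question (PLMS 2024 §1 p. 5) and EC(3,2) stay OPEN; EAC ⇏ SC.
-/

set_option linter.dupNamespace false

namespace Summit.Schanuel.Schanuel.Theorems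

section NewtonLowerEdge

/-- Bézout completion: coprime `a, b` complete to a unimodular matrix `a d − b c = 1`.
[folklore] -/
theorem exists_unimodular_completion {a b : ℤ} (h : Int.gcd a b = 1) :
    ∃ c d : ℤ, a * d - b * c = 1 := by
  refine ⟨-Int.gcdB a b, Int.gcdA a b, ?_⟩
  have := Int.gcd_eq_gcd_ab a b
  rw [h] at this
  push_cast at this
  linarith

/-- **A LOWER EDGE OF THE NEWTON POLYGON.**  For a finite `S ⊂ ℕ × ℕ` containing two points with
distinct first coordinates there are integers `a ≥ 1`, `b`, `c`, `d` with `a d − b c = 1` and two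
distinct points `m₁, m₂ ∈ S` at which the functional `ℓ(i, j) = a j − b i` attains its minimum
over `S`. [folklore] (new in this form) -/
theorem exists_lowerEdge (S : Finset (ℕ × ℕ)) (h : ∃ m₁ ∈ S, ∃ m₂ ∈ S, m₁.1 ≠ m₂.1) :
    ∃ (a b c d : ℤ), 1 ≤ a ∧ a * d - b * c = 1 ∧
      ∃ m₁ ∈ S, ∃ m₂ ∈ S, m₁ ≠ m₂ ∧
        a * (m₁.2 : ℤ) - b * m₁.1 = a * m₂.2 - b * m₂.1 ∧
        ∀ m ∈ S, a * (m₁.2 : ℤ) - b * m₁.1 ≤ a * m.2 - b * m.1 := by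
  classical
  obtain ⟨p₁, hp₁, p₂, hp₂, hp₁₂⟩ := h
  have hSne : S.Nonempty := ⟨p₁, hp₁⟩
  -- the lowest point `m₀` (minimal `j`, then minimal `i`)
  obtain ⟨mj, hmjS, hmj⟩ := Finset.exists_min_image S (fun m : ℕ × ℕ => m.2) hSne
  set S₀ := S.filter (fun m : ℕ × ℕ => m.2 = mj.2) with hS₀
  have hS₀ne : S₀.Nonempty := ⟨mj, Finset.mem_filter.2 ⟨hmjS, rfl⟩⟩
  obtain ⟨m₀, hm₀S₀, hm₀⟩ := Finset.exists_min_image S₀ (fun m : ℕ × ℕ => m.1) hS₀ne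
  obtain ⟨hm₀S, hm₀j⟩ := Finset.mem_filter.1 hm₀S₀
  have hjmin : ∀ m ∈ S, m₀.2 ≤ m.2 := fun m hm => by rw [hm₀j]; exact hmj m hm
  have himin : ∀ m ∈ S, m.2 = m₀.2 → m₀.1 ≤ m.1 := fun m hm hj =>
    hm₀ m (Finset.mem_filter.2 ⟨hm, by rw [hj, hm₀j]⟩)
  set i₀ : ℤ := (m₀.1 : ℤ) with hi₀
  set j₀ : ℤ := (m₀.2 : ℤ) with hj₀
  -- Case 1: a second point on the bottom row (bottom edge)
  by_cases hbot : ∃ m ∈ S, m ≠ m₀ ∧ m.2 = m₀.2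
  · obtain ⟨m, hmS, hmne, hmj'⟩ := hbot
    refine ⟨1, 0, 0, 1, le_refl _, by ring, m₀, hm₀S, m, hmS, hmne.symm, ?_, fun m' hm' => ?_⟩
    · simp [hmj']
    · have := hjmin m' hm'
      simp only [one_mul, zero_mul, sub_zero]
      exact_mod_cast this
  -- Case 2: `m₀` is the unique lowest point
  have hstrict : ∀ m ∈ S, m ≠ m₀ → m₀.2 < m.2 := by
    intro m hm hne
    rcases (hjmin m hm).lt_or_eq with hlt | heq
    · exact hlt
    · exact absurd ⟨m, hm, hne, heq.symm⟩ hbot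
  by_cases hT : ∃ m ∈ S, m₀.1 < m.1
  · -- Case 2a: tilt to the right
    set T := S.filter (fun m : ℕ × ℕ => m₀.1 < m.1) with hTdef
    have hTne : T.Nonempty := by
      obtain ⟨m, hm, hlt⟩ := hT
      exact ⟨m, Finset.mem_filter.2 ⟨hm, hlt⟩⟩
    obtain ⟨m₂, hm₂T, hm₂⟩ := Finset.exists_min_image T
      (fun m : ℕ × ℕ => ((m.2 : ℤ) - j₀ : ℚ) / ((m.1 : ℤ) - i₀ : ℚ)) hTne
    obtain ⟨hm₂S, hm₂i⟩ := Finset.mem_filter.1 hm₂T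
    have hm₂ne : m₂ ≠ m₀ := fun h => by rw [h] at hm₂i; exact lt_irrefl _ hm₂i
    have hm₂j : m₀.2 < m₂.2 := hstrict m₂ hm₂S hm₂ne
    set A : ℤ := (m₂.1 : ℤ) - i₀ with hA
    set B : ℤ := (m₂.2 : ℤ) - j₀ with hB
    have hA0 : 0 < A := by rw [hA, hi₀]; omega
    have hB0 : 0 < B := by rw [hB, hj₀]; omega
    -- cross-multiplied minimality
    have hcross : ∀ m ∈ T, B * ((m.1 : ℤ) - i₀) ≤ ((m.2 : ℤ) - j₀) * A := by
      intro m hm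
      obtain ⟨-, hmi⟩ := Finset.mem_filter.1 hm
      have hden : (0 : ℚ) < ((m.1 : ℤ) - i₀ : ℚ) := by
        have : i₀ < (m.1 : ℤ) := by rw [hi₀]; exact_mod_cast hmi
        exact_mod_cast sub_pos.2 this
      have hA0' : (0 : ℚ) < (A : ℚ) := by exact_mod_cast hA0
      have h1 := hm₂ m hm
      have h2 : ((B : ℤ) : ℚ) / (A : ℚ) ≤ ((m.2 : ℤ) - j₀ : ℚ) / ((m.1 : ℤ) - i₀ : ℚ) := by
        rw [hA, hB]; push_cast; push_cast at h1; exact h1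
      rw [div_le_div_iff₀ hA0' hden] at h2
      exact_mod_cast h2
    -- primitive direction
    obtain ⟨g, a, b, hg, hab, hAa, hBb⟩ := Int.exists_gcd_one' (Int.gcd_pos_of_ne_zero_left B hA0.ne')
    have hg' : (0 : ℤ) < g := by exact_mod_cast hg
    have ha0 : 0 < a := by
      rw [hAa] at hA0
      exact pos_of_mul_pos_left hA0 hg'.le
    have hb0 : 0 < b := by
      rw [hBb] at hB0
      exact pos_of_mul_pos_left hB0 hg'.le
    obtain ⟨c, d, hcd⟩ := exists_unimodular_completion hab
    refine ⟨a, b, c, d, ha0, hcd, m₀, hm₀S, m₂, hm₂S, hm₂ne.symm, ?_, fun m hm => ?_⟩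
    · -- equality at `m₂`: `a B = b A`
      have e : a * B = b * A := by rw [hAa, hBb]; ring
      rw [hA, hB] at e
      linarith
    · by_cases hmT : m₀.1 < m.1
      · have h1 := hcross m (Finset.mem_filter.2 ⟨hm, hmT⟩)
        rw [hAa, hBb] at h1
        have h2 : b * ((m.1 : ℤ) - i₀) ≤ ((m.2 : ℤ) - j₀) * a := by
          have h3 : b * ((m.1 : ℤ) - i₀) * g ≤ ((m.2 : ℤ) - j₀) * a * g := by
            calc b * ((m.1 : ℤ) - i₀) * g = b * g * ((m.1 : ℤ) - i₀) := by ring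
              _ ≤ ((m.2 : ℤ) - j₀) * (a * g) := h1
              _ = ((m.2 : ℤ) - j₀) * a * g := by ring
          exact le_of_mul_le_mul_right h3 hg'
        linarith
      · push Not at hmT
        by_cases hme : m = m₀
        · rw [hme]
        · have hj := hstrict m hm hme
          have h1 : (1 : ℤ) ≤ (m.2 : ℤ) - j₀ := by rw [hj₀]; omega
          have h2 : (m.1 : ℤ) - i₀ ≤ 0 := by rw [hi₀]; omega
          nlinarith
  · -- Case 2b: every point is to the left of (or above) `m₀`: tilt to the left
    push Not at hT
    have hT' : ∃ m ∈ S, m.1 < m₀.1 := by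
      by_cases h1 : p₁.1 = m₀.1
      · refine ⟨p₂, hp₂, lt_of_le_of_ne (hT p₂ hp₂) ?_⟩
        rw [← h1]; exact fun h => hp₁₂ h.symm
      · exact ⟨p₁, hp₁, lt_of_le_of_ne (hT p₁ hp₁) h1⟩
    set T := S.filter (fun m : ℕ × ℕ => m.1 < m₀.1) with hTdef
    have hTne : T.Nonempty := by
      obtain ⟨m, hm, hlt⟩ := hT'
      exact ⟨m, Finset.mem_filter.2 ⟨hm, hlt⟩⟩
    obtain ⟨m₂, hm₂T, hm₂⟩ := Finset.exists_min_image T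
      (fun m : ℕ × ℕ => ((m.2 : ℤ) - j₀ : ℚ) / (i₀ - (m.1 : ℤ) : ℚ)) hTne
    obtain ⟨hm₂S, hm₂i⟩ := Finset.mem_filter.1 hm₂T
    have hm₂ne : m₂ ≠ m₀ := fun h => by rw [h] at hm₂i; exact lt_irrefl _ hm₂i
    have hm₂j : m₀.2 < m₂.2 := hstrict m₂ hm₂S hm₂ne
    set A : ℤ := i₀ - (m₂.1 : ℤ) with hA
    set B : ℤ := (m₂.2 : ℤ) - j₀ with hB
    have hA0 : 0 < A := by rw [hA, hi₀]; omega
    have hB0 : 0 < B := by rw [hB, hj₀]; omega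
    have hcross : ∀ m ∈ T, B * (i₀ - (m.1 : ℤ)) ≤ ((m.2 : ℤ) - j₀) * A := by
      intro m hm
      obtain ⟨-, hmi⟩ := Finset.mem_filter.1 hm
      have hden : (0 : ℚ) < (i₀ - (m.1 : ℤ) : ℚ) := by
        have : (m.1 : ℤ) < i₀ := by rw [hi₀]; exact_mod_cast hmi
        exact_mod_cast sub_pos.2 this
      have hA0' : (0 : ℚ) < (A : ℚ) := by exact_mod_cast hA0
      have h1 := hm₂ m hm
      have h2 : ((B : ℤ) : ℚ) / (A : ℚ) ≤ ((m.2 : ℤ) - j₀ : ℚ) / (i₀ - (m.1 : ℤ) : ℚ) := by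
        rw [hA, hB]; push_cast; push_cast at h1; exact h1
      rw [div_le_div_iff₀ hA0' hden] at h2
      exact_mod_cast h2
    obtain ⟨g, a, b', hg, hab, hAa, hBb⟩ := Int.exists_gcd_one' (Int.gcd_pos_of_ne_zero_left B hA0.ne')
    have hg' : (0 : ℤ) < g := by exact_mod_cast hg
    have ha0 : 0 < a := by
      rw [hAa] at hA0
      exact pos_of_mul_pos_left hA0 hg'.le
    have hb0 : 0 < b' := by
      rw [hBb] at hB0
      exact pos_of_mul_pos_left hB0 hg'.le
    -- `gcd a b' = 1`: `1 = a·gcdA + b'·gcdB`; with `b = -b'` take `d = gcdA`, `c = gcdB`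
    have hbez : a * Int.gcdA a b' + b' * Int.gcdB a b' = 1 := by
      have := Int.gcd_eq_gcd_ab a b'
      rw [hab] at this
      push_cast at this
      linarith
    refine ⟨a, -b', Int.gcdB a b', Int.gcdA a b', ha0, by linarith, m₀, hm₀S, m₂, hm₂S, hm₂ne.symm,
      ?_, fun m hm => ?_⟩
    · have e : a * B = b' * A := by rw [hAa, hBb]; ring
      rw [hA, hB] at e
      linarith
    · by_cases hmT : m.1 < m₀.1
      · have h1 := hcross m (Finset.mem_filter.2 ⟨hm, hmT⟩)
        rw [hAa, hBb] at h1
        have h2 : b' * (i₀ - (m.1 : ℤ)) ≤ ((m.2 : ℤ) - j₀) * a := by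
          have h3 : b' * (i₀ - (m.1 : ℤ)) * g ≤ ((m.2 : ℤ) - j₀) * a * g := by
            calc b' * (i₀ - (m.1 : ℤ)) * g = b' * g * (i₀ - (m.1 : ℤ)) := by ring
              _ ≤ ((m.2 : ℤ) - j₀) * (a * g) := h1
              _ = ((m.2 : ℤ) - j₀) * a * g := by ring
          exact le_of_mul_le_mul_right h3 hg'
        linarith
      · push Not at hmT
        have hmi : m.1 = m₀.1 := le_antisymm (hT m hm) hmT
        by_cases hme : m = m₀
        · rw [hme]
        · have hj := hstrict m hm hme
          have h1 : (1 : ℤ) ≤ (m.2 : ℤ) - j₀ := by rw [hj₀]; omega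
          have h2 : (m.1 : ℤ) - i₀ = 0 := by rw [hi₀, hmi]; ring
          nlinarith

end NewtonLowerEdge

end Summit.Schanuel.Schanuel.Theorems
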